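import Summits.KontsevichZagierPeriods.KontsevichZagierPeriods.Theses.FermatIsogeny
import Summits.KontsevichZagierPeriods.KontsevichZagierPeriods.Theorems.FermatIsogenyBetaProductSectorStubProductValue
import Summits.KontsevichZagierPeriods.KontsevichZagierPeriods.Theorems.FermatIsogenyBetaProductSectorStubLinearFactor
import Summits.KontsevichZagierPeriods.KontsevichZagierPeriods.Theorems.FermatIsogenyBetaProductSectorDefs
import Summits.KontsevichZagierPeriods.KontsevichZagierPeriods.Theorems.FermatIsogenyBetaProductSectorStubLinConstant
import Literature.NumberTheory.Transcendental.KZCubeProducts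
import Literature.NumberTheory.Transcendental.KZProductIdeal
import Literature.NumberTheory.Transcendental.KZRelationsLE

/-!
# `BetaProductSector` (stmt-KontsevichZagierPeriods-3898, route FermatIsogeny, rank 4) — line `registered`, v3
# (RESHAPE by lead c3, 2026-08-17): TRANSCENDENCE ⊕ COMBINATORICS ⊕ UNIFORM KZ-STEPS

Crux: Conjecture 1 of Kontsevich–Zagier on the beta-PRODUCT sector (dimension 2): if
`B(a,b)B(e,d) = q · B(a',b')B(e',d')` (`q` real algebraic, eight positive rationals) then the two pinned product
representations on `(0,1)²` are `KZ.Equivalent`.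

History. v1 (`birth`, planner) / v2 (lead c1): stubs GENERATION (every such identity is a finite chain of
LIN / SWAP / DIR steps through length-2 words) + VALUE + the tensored LIN step + DIR; VALUE, DIR and LIN⊗β (modulo
crux 3) LANDED (p148950, p149535, p151201). Leads c1 and c2 ended `line-dead` at GENERATION: the LIN+SWAP+DIR(+QUAD)
step graph on weight-0 Hodge classes of (2,2) words is disconnected from level 21/22 on (c2: "rigid Galois-conjugate
atoms, no pattern move acts on them"). Lead c3 (this file) found that verdict to be an artefact of a too-small step
set: a schema-FREE search for one-parameter-family moves (Γ-divisor criterion, `compute/uniform_moves.py`) reconnects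
ALL bad classes at levels 15 and 22 with slopes in {−1,0,1} (260 uniform moves at level 22; the rigid–rigid target
`{(1,2),(5,7)}/22` is ONE move away from `{(1,5),(1,7)}` by the new two-duplication identity
`B(u,u+4p)B(p,½−3p−u) = 4^{1−u−3p}cos(π(u+2p))·B(u,2p)B(u+4p,½−3p−u)`), all 40 classes at level 22 with FULLY
uniform moves of slope ≤ 2, and sampled level-25 classes with order-5 moves
(`B(x,y)B(x,y+⅕) = c·B(x,5y)B(x,3y+⅕)`, `x = ⅕−2y`). Dossier: `Cruxes/BetaProductSector/REVIVAL.md`.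

v3 keeps the COMPOSITION IDEA (induction along a chain of 2-word moves, every move a KZ equivalence, no
cancellation) and re-cuts the generation stub along its two natures:

* `stub_hodgeType` — VALUE ⇒ HODGE TYPE (transcendence; verbatim the strategist's split child
  `BetaProductHodgeType`; the (2,2) weight-0 Lang–Rohrlich fragment, conjecture-grade; NO KZ content).
* `stub_combGeneration` — HODGE TYPE ⇒ CHAIN: Hodge-equal words are connected by finitely many steps
  `Step = LinStep ∨ SwapStep ∨ UniformStep` (`Theorems/FermatIsogenyBetaProductSectorDefs.lean`): replace the first atom
  by a HODGE-EQUAL atom, swap the atoms, or apply a FULLY UNIFORM one-parameter move (Gauss multiplication in the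
  parameter + reflection + translation, decided by the Γ-divisor criterion `IsFullyUniform`; DIR and QUAD are
  instances). Pure arithmetic, decidable per instance; computational evidence in REVIVAL.md: levels 9, 15, 22 complete — at
  level 22 three named reflection-free duplication schemas QUAD, DD, X9 + DIR + Hodge-LIN already connect ALL classes (§9) —,
  21/25 sampled, farm census j026251–3 pending. Conjecture-grade as a ∀-statement. Das 2-torsion is NOT an obstruction here:
  all (2,2) class pairs at 15/21/22 are standard modulo Hodge-LIN; the Das content sits in crux 3's (1,1) coincidences (§7).
* `stub_uniformStep` — every fully uniform move is a KZ equivalence of the pinned representations (uniformly in the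
  weight). This is the KZ content of the line; crux-sized as a whole; instances land `--supports`: DIR (p149535), QUAD =
  `stub_quadStep` LANDED p162508 (7-move cancellation-free chain: Kummer coverings, symmetric chart of the wedge, wedge fold;
  `quad_isFullyUniform` p163253, `quad_uniformStep` p163386), DD (`stub_ddStep`) and X9 (`stub_twinDupStep`) — fully uniform and
  UniformSteps in Lean (p163253, p163526) — are LANDED as KZ equivalences too: `stub_ddStep` p168330, `stub_twinDupStep` p171515
  (branch exchange on a parameter surface — an algebraic correspondence inside the naive calculus); with DIR they finish level 22.
  The odd-order instance Q5 (`stub_quintStep`, level 25) is blocked on `TerasomaMultiplication.BetaCancellation` (stmt-13633):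
  an invariant of the present word calculus (REVIVAL §11) separates orders 2, 3 from orders ≥ 5.
* `stub_linConstant` — HODGE-EQUAL ATOMS HAVE ALGEBRAICALLY PROPORTIONAL VALUES (Koblitz–Ogus): CLOSED — `stub_linConstantRaw`
  p160698 (from `deligne_gammaMonomial_algebraic_holds`) + `stub_linConstant` p161781; no sorry below.
* `stub_betaLinearSector` — route crux 3 verbatim (the LIN step's KZ content, via the landed
  `stub_linearFactor_of_betaLinearSector`).

Composition (sorry-free, `betaProductSector_of_stubs`): values ⇒ the Beta identity (landed VALUE) ⇒ Hodge equality
(`stub_hodgeType`) ⇒ a chain (`stub_combGeneration`) ⇒ induction along the chain with the invariant "for every real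
algebraic `κ` with `B(w) = κ·B(p)`, every representation pinned to `(p; κ)` is equivalent to `r`": LIN steps by
`stub_linConstant` + crux 3 (tensored, landed), SWAP by relabelling, uniform steps by `stub_uniformStep`.
`BetaProductSector_of : BetaProductSector` feeds the stubs in BY NAME. Vocabulary: `Theorems/FermatIsogenyBetaProductSectorDefs.lean`
(p159833, LANDED). `stub_linConstantRaw` (the Defs-free unfolding of `stub_linConstant`) LANDED p160698. Disproof used: none on file for this crux.
-/

set_option linter.dupNamespace false

noncomputable section



namespace Summit.KontsevichZagierPeriods.KontsevichZagierPeriods.Cruxes.BetaProductSector.Registered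

open Summit.KontsevichZagierPeriods.KontsevichZagierPeriods.Theses.FermatIsogeny (BetaProductSector BetaLinearSector)
open Summit.KontsevichZagierPeriods.FermatIsogeny.BetaProductSectorDefs
open Literature.NumberTheory.Transcendental

/-! ## The stubs -/

/-- Stub 1 — VALUE ⇒ HODGE TYPE (transcendence atom; the split child `BetaProductHodgeType` verbatim): a Beta-product
identity with a real-algebraic factor forces equality of the weight-0 Hodge functions of the two words at every unit.
The (2,2) instance of the Lang–Rohrlich programme (the (1,1) case is Wolfart–Wüstholz 1985); conjecture-grade, no KZ
content. [cite: Deligne1982HodgeCycles, Thm. 7.18] -/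
theorem stub_hodgeType : ∀ (a b e d a' b' e' d' : ℚ) (q : ℝ), 0 < a → 0 < b → 0 < e → 0 < d → 0 < a' → 0 < b' → 0 < e' → 0 < d' → IsAlgebraic ℚ q → ProbabilityTheory.beta (a:ℝ) b * ProbabilityTheory.beta (e:ℝ) d = q * (ProbabilityTheory.beta (a':ℝ) b' * ProbabilityTheory.beta (e':ℝ) d') → ∀ u : ℕ, 0 < u → Nat.Coprime u a.den → Nat.Coprime u b.den → Nat.Coprime u e.den → Nat.Coprime u d.den → Nat.Coprime u a'.den → Nat.Coprime u b'.den → Nat.Coprime u e'.den → Nat.Coprime u d'.den → (Int.fract ((u:ℚ) * a) + Int.fract ((u:ℚ) * b) - Int.fract ((u:ℚ) * (a + b))) + (Int.fract ((u:ℚ) * e) + Int.fract ((u:ℚ) * d) - Int.fract ((u:ℚ) * (e + d))) = (Int.fract ((u:ℚ) * a') + Int.fract ((u:ℚ) * b') - Int.fract ((u:ℚ) * (a' + b'))) + (Int.fract ((u:ℚ) * e') + Int.fract ((u:ℚ) * d') - Int.fract ((u:ℚ) * (e' + d'))) := by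
  sorry

/-- Stub 2 — HODGE-EQUAL ATOMS ARE ALGEBRAICALLY PROPORTIONAL (Koblitz–Ogus direction): LANDED (lead c3, worker W1 +
repackaging): `BetaProductSectorStubs.stub_linConstantRaw` (p160698, from `deligne_gammaMonomial_algebraic_holds`) and
`BetaProductSectorStubs.stub_linConstant` (p161781). Kept as a named theorem of the skeleton so the stub list documents the
seam; no sorry. [cite: Deligne1982HodgeCycles, Thm. 7.18] -/
theorem stub_linConstant : ∀ (a₁ b₁ a₂ b₂ : ℚ), 0 < a₁ → 0 < b₁ → 0 < a₂ → 0 < b₂ → Summit.KontsevichZagierPeriods.FermatIsogeny.BetaProductSectorDefs.HodgeEqAtoms a₁ b₁ a₂ b₂ → ∃ c : ℝ, IsAlgebraic ℚ c ∧ 0 < c ∧ ProbabilityTheory.beta (a₁:ℝ) b₁ = c * ProbabilityTheory.beta (a₂:ℝ) b₂ :=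
  Summit.KontsevichZagierPeriods.FermatIsogeny.BetaProductSectorStubs.stub_linConstant

/-- Stub 3 — COMBINATORIAL GENERATION (HODGE TYPE ⇒ CHAIN): two positive (2,2) words with equal weight-0 Hodge
functions are connected by a finite chain of steps (Hodge-equal first atoms / swap / fully uniform one-parameter
move). Decidable per instance; evidence: the uniform-move census of lead c3 (REVIVAL.md). Conjecture-grade as a
∀-statement. [cite: Deligne1982HodgeCycles, Thm. 7.18] -/
theorem stub_combGeneration : ∀ (a b e d a' b' e' d' : ℚ), 0 < a → 0 < b → 0 < e → 0 < d → 0 < a' → 0 < b' → 0 < e' → 0 < d' → Summit.KontsevichZagierPeriods.FermatIsogeny.BetaProductSectorDefs.HodgeEqWords a b e d a' b' e' d' → Relation.ReflTransGen Summit.KontsevichZagierPeriods.FermatIsogeny.BetaProductSectorDefs.Step ((a, b), (e, d)) ((a', b'), (e', d')) := by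
  sorry

/-- Stub 4 — FULLY UNIFORM MOVES ARE KZ EQUIVALENCES (the KZ content of the line): for a fully uniform one-parameter
move whose base-point identity `B(x₁,y₁)B(x₂,y₂) = c·B(x₃,y₃)B(x₄,y₄)` holds with `c` real algebraic, the
representations pinned to `((x₁,y₁),(x₂,y₂); κ)` and `((x₃,y₃),(x₄,y₄); κc)` are equivalent for every real algebraic
weight `κ`. Contains Dirichlet re-association (landed), the quadratic move, the two-duplication move D2 and the order-5
move Q5; crux-sized as a whole, instances land `--supports`. [cite: KontsevichZagier2001, §1.2 Conjecture 1] -/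
theorem stub_uniformStep : ∀ (x₁ y₁ x₂ y₂ x₃ y₃ x₄ y₄ : ℚ) (n₁ n₂ n₃ n₄ n₅ n₆ n₇ n₈ : ℤ) (c κ : ℝ), 0 < x₁ → 0 < y₁ → 0 < x₂ → 0 < y₂ → 0 < x₃ → 0 < y₃ → 0 < x₄ → 0 < y₄ → Summit.KontsevichZagierPeriods.FermatIsogeny.BetaProductSectorDefs.IsFullyUniform x₁ y₁ x₂ y₂ x₃ y₃ x₄ y₄ n₁ n₂ n₃ n₄ n₅ n₆ n₇ n₈ → IsAlgebraic ℚ c → ProbabilityTheory.beta (x₁:ℝ) y₁ * ProbabilityTheory.beta (x₂:ℝ) y₂ = c * (ProbabilityTheory.beta (x₃:ℝ) y₃ * ProbabilityTheory.beta (x₄:ℝ) y₄) → IsAlgebraic ℚ κ → ∀ (r r' : Literature.NumberTheory.Transcendental.KZ.IntegralRep 2), Summit.KontsevichZagierPeriods.FermatIsogeny.BetaProductSectorDefs.IsPinned x₁ y₁ x₂ y₂ κ r → Summit.KontsevichZagierPeriods.FermatIsogeny.BetaProductSectorDefs.IsPinned x₃ y₃ x₄ y₄ (κ * c) r' → Literature.NumberTheory.Transcendental.KZ.Equivalent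 r r' := by
  sorry

/-- Stub 5 — THE BETA-LINEAR SECTOR, route crux 3 `FermatIsogeny.BetaLinearSector` (stmt-KontsevichZagierPeriods-3897)
VERBATIM (the LIN step's KZ content; tensoring with `β(e,d)` is landed as
`BetaProductSectorStubs.stub_linearFactor_of_betaLinearSector`). Own lead; not worked in this line.
[cite: KoblitzRohrlich1978, p. 1184] -/
theorem stub_betaLinearSector : BetaLinearSector := by
  sorry

/-! ## Glue (sorry-free) -/

/-- Pinned product representations EXIST at every positive word with a real-algebraic weight (`KZ.exists_cubeBetaRep`
scaled by `IntegralRep.constMul`). [cite: KontsevichZagier2001, §1.1] -/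
theorem exists_pinned (a b e d : ℚ) (c : ℝ) (ha : 0 < a) (hb : 0 < b) (he : 0 < e) (hd : 0 < d)
    (hc : IsAlgebraic ℚ c) : ∃ s : KZ.IntegralRep 2, IsPinned a b e d c s := by
  obtain ⟨r₀, hd₀, hi₀⟩ := KZ.exists_cubeBetaRep (N := 2) ![a, e] ![b, d]
    (Fin.forall_fin_two.2 ⟨by simpa using And.intro ha hb, by simpa using And.intro he hd⟩)
  refine ⟨r₀.constMul c hc, hd₀, fun x hx => ?_⟩
  have hx₀ : x ∈ r₀.domain := hx
  rw [KZ.IntegralRep.integrand_constMul]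
  simp only
  rw [hi₀ hx₀]
  simp only [Fin.prod_univ_two, Matrix.cons_val_zero, Matrix.cons_val_one]
  ring

/-- SWAP is a coordinate relabelling (`KZ.of_sub_of_reindex_mem_relations` along `Equiv.swap 0 1`).
[cite: KontsevichZagier2001, §1.2 rule (2)] -/
theorem swap_pinned (a b e d : ℚ) (c : ℝ) (t : KZ.IntegralRep 2) (ht : IsPinned e d a b c t) :
    ∃ s : KZ.IntegralRep 2, IsPinned a b e d c s ∧ KZ.Equivalent s t := by
  obtain ⟨htd, hti⟩ := ht
  refine ⟨t.reindex (Equiv.swap (0 : Fin 2) 1), ⟨?_, fun w hw => ?_⟩, ?_⟩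
  · ext w
    simp only [KZ.IntegralRep.reindex_domain, htd, Set.mem_setOf_eq]
    constructor
    · intro h i
      simpa using h (Equiv.swap (0 : Fin 2) 1 i)
    · intro h i
      exact h _
  · have hw' : (fun i => w (Equiv.swap (0 : Fin 2) 1 i)) ∈ t.domain := hw
    rw [KZ.IntegralRep.reindex_integrand]
    simp only
    rw [hti hw']
    simp only [Equiv.swap_apply_left, Equiv.swap_apply_right]
    ring
  · have h : KZ.Equivalent t (t.reindex (Equiv.swap (0 : Fin 2) 1)) :=
      KZ.of_sub_of_reindex_mem_relations t (Equiv.swap (0 : Fin 2) 1)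
    exact h.symm

/-- Two representations pinned to the same weighted word are equivalent (one integrand-additivity move).
[cite: KontsevichZagier2001, §1.2 rule (1)] -/
theorem pinned_unique {a b e d : ℚ} {c : ℝ} (s t : KZ.IntegralRep 2) (hs : IsPinned a b e d c s)
    (ht : IsPinned a b e d c t) : KZ.Equivalent s t :=
  KZ.of_sub_of_mem_relations_of_eqOn (ht.1.trans hs.1.symm) fun x hx =>
    (hs.2 hx).trans (ht.2 (by rw [ht.1]; rw [hs.1] at hx; exact hx)).symm

/-- A pinning with weight `κ'` is a pinning with weight `κ * c` when `κ' = κ * c`. [folklore] -/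
theorem isPinned_congr_weight {a b e d : ℚ} {κ κ' : ℝ} (h : κ' = κ) {s : KZ.IntegralRep 2}
    (hs : IsPinned a b e d κ' s) : IsPinned a b e d κ s := h ▸ hs

/-- The composition, arrow form: HODGE TYPE → LIN CONSTANT → GENERATION → UNIFORM STEP → VALUE → LINEAR STEP → the
crux (UNFOLDED verbatim, so that exactly one theorem of this file, `BetaProductSector_of`, concludes the crux by name).
[cite: KontsevichZagier2001, §1.2] -/
theorem betaProductSector_of_stubs
    (hT : ∀ (a b e d a' b' e' d' : ℚ) (q : ℝ), 0 < a → 0 < b → 0 < e → 0 < d → 0 < a' → 0 < b' → 0 < e' → 0 < d' → IsAlgebraic ℚ q → ProbabilityTheory.beta (a:ℝ) b * ProbabilityTheory.beta (e:ℝ) d = q * (ProbabilityTheory.beta (a':ℝ) b' * ProbabilityTheory.beta (e':ℝ) d') → ∀ u : ℕ, 0 < u → Nat.Coprime u a.den → Nat.Coprime u b.den → Nat.Coprime u e.den → Nat.Coprime u d.den → Nat.Coprime u a'.den → Nat.Coprime u b'.den → Nat.Coprime u e'.den → Nat.Coprime u d'.den → (Int.fract ((u:ℚ) * a) + Int.fract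 ((u:ℚ) * b) - Int.fract ((u:ℚ) * (a + b))) + (Int.fract ((u:ℚ) * e) + Int.fract ((u:ℚ) * d) - Int.fract ((u:ℚ) * (e + d))) = (Int.fract ((u:ℚ) * a') + Int.fract ((u:ℚ) * b') - Int.fract ((u:ℚ) * (a' + b'))) + (Int.fract ((u:ℚ) * e') + Int.fract ((u:ℚ) * d') - Int.fract ((u:ℚ) * (e' + d'))))
    (hKO : ∀ (a₁ b₁ a₂ b₂ : ℚ), 0 < a₁ → 0 < b₁ → 0 < a₂ → 0 < b₂ → Summit.KontsevichZagierPeriods.FermatIsogeny.BetaProductSectorDefs.HodgeEqAtoms a₁ b₁ a₂ b₂ → ∃ c : ℝ, IsAlgebraic ℚ c ∧ 0 < c ∧ ProbabilityTheory.beta (a₁:ℝ) b₁ = c * ProbabilityTheory.beta (a₂:ℝ) b₂)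
    (hcomb : ∀ (a b e d a' b' e' d' : ℚ), 0 < a → 0 < b → 0 < e → 0 < d → 0 < a' → 0 < b' → 0 < e' → 0 < d' → Summit.KontsevichZagierPeriods.FermatIsogeny.BetaProductSectorDefs.HodgeEqWords a b e d a' b' e' d' → Relation.ReflTransGen Summit.KontsevichZagierPeriods.FermatIsogeny.BetaProductSectorDefs.Step ((a, b), (e, d)) ((a', b'), (e', d')))
    (hunif : ∀ (x₁ y₁ x₂ y₂ x₃ y₃ x₄ y₄ : ℚ) (n₁ n₂ n₃ n₄ n₅ n₆ n₇ n₈ : ℤ) (c κ : ℝ), 0 < x₁ → 0 < y₁ → 0 < x₂ → 0 < y₂ → 0 < x₃ → 0 < y₃ → 0 < x₄ → 0 < y₄ → Summit.KontsevichZagierPeriods.FermatIsogeny.BetaProductSectorDefs.IsFullyUniform x₁ y₁ x₂ y₂ x₃ y₃ x₄ y₄ n₁ n₂ n₃ n₄ n₅ n₆ n₇ n₈ → IsAlgebraic ℚ c → ProbabilityTheory.beta (x₁:ℝ) y₁ * ProbabilityTheory.beta (x₂:ℝ) y₂ = c * (ProbabilityTheory.beta (x₃:ℝ) y₃ * ProbabilityTheory.beta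 (x₄:ℝ) y₄) → IsAlgebraic ℚ κ → ∀ (r r' : Literature.NumberTheory.Transcendental.KZ.IntegralRep 2), Summit.KontsevichZagierPeriods.FermatIsogeny.BetaProductSectorDefs.IsPinned x₁ y₁ x₂ y₂ κ r → Summit.KontsevichZagierPeriods.FermatIsogeny.BetaProductSectorDefs.IsPinned x₃ y₃ x₄ y₄ (κ * c) r' → Literature.NumberTheory.Transcendental.KZ.Equivalent r r')
    (hval : ∀ (a b e d : ℚ) (c : ℝ), 0 < a → 0 < b → 0 < e → 0 < d → ∀ (r : Literature.NumberTheory.Transcendental.KZ.IntegralRep 2), r.domain = {x | ∀ i, x i ∈ Set.Ioo (0:ℝ) 1} → Set.EqOn r.integrand (fun x => c * (x 0) ^ ((a:ℝ) - 1) * (1 - x 0) ^ ((b:ℝ) - 1) * (x 1) ^ ((e:ℝ) - 1) * (1 - x 1) ^ ((d:ℝ) - 1)) r.domain → r.value = c * ((Real.Gamma a * Real.Gamma b / Real.Gamma ((a:ℝ) + b)) * (Real.Gamma e * Real.Gamma d / Real.Gamma ((e:ℝ) + d))))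
    (hlin : ∀ (a b a' b' e d : ℚ) (c c' : ℝ), 0 < a → 0 < b → 0 < a' → 0 < b' → 0 < e → 0 < d → IsAlgebraic ℚ c → IsAlgebraic ℚ c' → c * (Real.Gamma a * Real.Gamma b / Real.Gamma ((a:ℝ) + b)) = c' * (Real.Gamma a' * Real.Gamma b' / Real.Gamma ((a':ℝ) + b')) → ∀ (r r' : Literature.NumberTheory.Transcendental.KZ.IntegralRep 2), r.domain = {x | ∀ i, x i ∈ Set.Ioo (0:ℝ) 1} → Set.EqOn r.integrand (fun x => c * (x 0) ^ ((a:ℝ) - 1) * (1 - x 0) ^ ((b:ℝ) - 1) * (x 1) ^ ((e:ℝ) - 1) * (1 - x 1) ^ ((d:ℝ) - 1)) r.domain → r'.domain = {x | ∀ i, x i ∈ Set.Ioo (0:ℝ) 1} → Set.EqOn r'.integrand (fun x => c' * (x 0) ^ ((a':ℝ) - 1) * (1 - x 0) ^ ((b':ℝ) - 1) * (x 1) ^ ((e:ℝ) - 1) * (1 - x 1) ^ ((d:ℝ) - 1)) r'.domain → Literature.NumberTheory.Transcendental.KZ.Equivalent r r') :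
    ∀ (a b e d a' b' e' d' : ℚ) (q : ℝ), 0 < a → 0 < b → 0 < e → 0 < d → 0 < a' → 0 < b' → 0 < e' → 0 < d' → IsAlgebraic ℚ q → ∀ (r r' : Literature.NumberTheory.Transcendental.KZ.IntegralRep 2), r.domain = {x | ∀ i, x i ∈ Set.Ioo (0:ℝ) 1} → Set.EqOn r.integrand (fun x => (x 0) ^ ((a:ℝ) - 1) * (1 - x 0) ^ ((b:ℝ) - 1) * (x 1) ^ ((e:ℝ) - 1) * (1 - x 1) ^ ((d:ℝ) - 1)) r.domain → r'.domain = {x | ∀ i, x i ∈ Set.Ioo (0:ℝ) 1} → Set.EqOn r'.integrand (fun x => q * (x 0) ^ ((a':ℝ) - 1) * (1 - x 0) ^ ((b':ℝ) - 1) * (x 1) ^ ((e':ℝ) - 1) * (1 - x 1) ^ ((d':ℝ) - 1)) r'.domain → r.value = r'.value → Literature.NumberTheory.Transcendental.KZ.Equivalent r r' := by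
  intro a b e d a' b' e' d' q ha hb he hd ha' hb' he' hd' hq r r' hrd hri hr'd hr'i hv
  -- `r` pinned with the weight `1`
  have hr1 : IsPinned a b e d 1 r := ⟨hrd, fun x hx => by simp only [hri hx, one_mul]⟩
  -- the Beta identity from the values
  have hβ : ProbabilityTheory.beta (a:ℝ) b * ProbabilityTheory.beta (e:ℝ) d =
      q * (ProbabilityTheory.beta (a':ℝ) b' * ProbabilityTheory.beta (e':ℝ) d') := by
    have h₁ := hval a b e d 1 ha hb he hd r hrd hr1.2
    have h₂ := hval a' b' e' d' q ha' hb' he' hd' r' hr'd hr'i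
    simp only [ProbabilityTheory.beta]
    rw [one_mul] at h₁
    rw [← h₁, ← h₂]
    exact hv
  -- positivity of the Beta values and of `q`
  have hβpos : ∀ {x y : ℚ}, 0 < x → 0 < y → 0 < ProbabilityTheory.beta (x:ℝ) y := fun hx hy =>
    ProbabilityTheory.beta_pos (by exact_mod_cast hx) (by exact_mod_cast hy)
  have hq0 : 0 < q := by
    have h1 : 0 < ProbabilityTheory.beta (a:ℝ) b * ProbabilityTheory.beta (e:ℝ) d :=
      mul_pos (hβpos ha hb) (hβpos he hd)
    have h2 : 0 < ProbabilityTheory.beta (a':ℝ) b' * ProbabilityTheory.beta (e':ℝ) d' :=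
      mul_pos (hβpos ha' hb') (hβpos he' hd')
    rw [hβ] at h1
    exact pos_of_mul_pos_left h1 h2.le
  -- Hodge equality of the two words (TRANSCENDENCE stub)
  have hH : HodgeEqWords a b e d a' b' e' d' := by
    intro u hu h1 h2 h3 h4 h5 h6 h7 h8
    have := hT a b e d a' b' e' d' q ha hb he hd ha' hb' he' hd' hq hβ u hu h1 h2 h3 h4 h5 h6 h7 h8
    simpa only [hodgeTerm] using this
  -- the chain (COMBINATORIAL stub)
  have hchain := hcomb a b e d a' b' e' d' ha hb he hd ha' hb' he' hd' hH
  -- invariant along the chain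
  suffices H : ∀ p : (ℚ × ℚ) × (ℚ × ℚ), Relation.ReflTransGen Step ((a, b), (e, d)) p →
      (0 < p.1.1 ∧ 0 < p.1.2 ∧ 0 < p.2.1 ∧ 0 < p.2.2) ∧
      ∀ κ : ℝ, IsAlgebraic ℚ κ →
        ProbabilityTheory.beta (a:ℝ) b * ProbabilityTheory.beta (e:ℝ) d =
          κ * (ProbabilityTheory.beta (p.1.1:ℝ) p.1.2 * ProbabilityTheory.beta (p.2.1:ℝ) p.2.2) →
        ∀ s : KZ.IntegralRep 2, IsPinned p.1.1 p.1.2 p.2.1 p.2.2 κ s → KZ.Equivalent r s by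
    exact (H _ hchain).2 q hq hβ r' ⟨hr'd, hr'i⟩
  intro p hp
  induction hp with
  | refl =>
    refine ⟨⟨ha, hb, he, hd⟩, fun κ hκ hid s hs => ?_⟩
    -- `κ = 1`
    have hpos : 0 < ProbabilityTheory.beta (a:ℝ) b * ProbabilityTheory.beta (e:ℝ) d :=
      mul_pos (hβpos ha hb) (hβpos he hd)
    have hκ1 : κ = 1 := by
      have h2 : κ * (ProbabilityTheory.beta (a:ℝ) b * ProbabilityTheory.beta (e:ℝ) d) =
          1 * (ProbabilityTheory.beta (a:ℝ) b * ProbabilityTheory.beta (e:ℝ) d) := by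
        rw [one_mul]; exact hid.symm
      exact mul_right_cancel₀ hpos.ne' h2
    subst hκ1
    exact pinned_unique r s hr1 hs
  | tail _ hstep ih =>
    obtain ⟨⟨hp1, hp2, hp3, hp4⟩, ihp⟩ := ih
    rcases hstep with ⟨a₁, b₁, a₂, b₂, e₁, d₁, ha₁, hb₁, ha₂, hb₂, he₁, hd₁, hHA, rfl, rfl⟩ |
        ⟨a₁, b₁, e₁, d₁, rfl, rfl⟩ |
        ⟨x₁, y₁, x₂, y₂, x₃, y₃, x₄, y₄, n₁, n₂, n₃, n₄, n₅, n₆, n₇, n₈, c, hx₁, hy₁, hx₂, hy₂, hx₃, hy₃, hx₄, hy₄,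
          hFU, hc, hid, rfl, rfl⟩
    · -- LIN step: Hodge-equal first atoms
      refine ⟨⟨ha₂, hb₂, he₁, hd₁⟩, fun κ' hκ' hid' s' hs' => ?_⟩
      obtain ⟨c, hc, hc0, hcid⟩ := hKO a₁ b₁ a₂ b₂ ha₁ hb₁ ha₂ hb₂ hHA
      have hκ : IsAlgebraic ℚ (κ' / c) := hκ'.mul hc.inv
      have hidκ : ProbabilityTheory.beta (a:ℝ) b * ProbabilityTheory.beta (e:ℝ) d =
          κ' / c * (ProbabilityTheory.beta (a₁:ℝ) b₁ * ProbabilityTheory.beta (e₁:ℝ) d₁) := by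
        rw [hid', hcid]; field_simp
      obtain ⟨s, hs⟩ := exists_pinned a₁ b₁ e₁ d₁ (κ' / c) ha₁ hb₁ he₁ hd₁ hκ
      refine (ihp (κ' / c) hκ hidκ s hs).trans ?_
      refine hlin a₁ b₁ a₂ b₂ e₁ d₁ (κ' / c) κ' ha₁ hb₁ ha₂ hb₂ he₁ hd₁ hκ hκ' ?_ s s' hs.1 hs.2 hs'.1 hs'.2
      have h1 : Real.Gamma a₁ * Real.Gamma b₁ / Real.Gamma ((a₁:ℝ) + b₁) = ProbabilityTheory.beta (a₁:ℝ) b₁ := rfl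
      have h2 : Real.Gamma a₂ * Real.Gamma b₂ / Real.Gamma ((a₂:ℝ) + b₂) = ProbabilityTheory.beta (a₂:ℝ) b₂ := rfl
      rw [h1, h2, hcid]; field_simp
    · -- SWAP
      refine ⟨⟨hp3, hp4, hp1, hp2⟩, fun κ' hκ' hid' s' hs' => ?_⟩
      obtain ⟨s, hs, hst⟩ := swap_pinned a₁ b₁ e₁ d₁ κ' s' hs'
      refine (ihp κ' hκ' ?_ s hs).trans hst
      rw [hid']; simp only; ring
    · -- fully uniform move
      refine ⟨⟨hx₃, hy₃, hx₄, hy₄⟩, fun κ' hκ' hid' s' hs' => ?_⟩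
      have hc0 : 0 < c := by
        have h1 : 0 < ProbabilityTheory.beta (x₁:ℝ) y₁ * ProbabilityTheory.beta (x₂:ℝ) y₂ :=
          mul_pos (hβpos hx₁ hy₁) (hβpos hx₂ hy₂)
        have h2 : 0 < ProbabilityTheory.beta (x₃:ℝ) y₃ * ProbabilityTheory.beta (x₄:ℝ) y₄ :=
          mul_pos (hβpos hx₃ hy₃) (hβpos hx₄ hy₄)
        rw [hid] at h1
        exact pos_of_mul_pos_left h1 h2.le
      have hκ : IsAlgebraic ℚ (κ' / c) := hκ'.mul hc.inv
      have hidκ : ProbabilityTheory.beta (a:ℝ) b * ProbabilityTheory.beta (e:ℝ) d =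
          κ' / c * (ProbabilityTheory.beta (x₁:ℝ) y₁ * ProbabilityTheory.beta (x₂:ℝ) y₂) := by
        rw [hid', hid]; field_simp
      obtain ⟨s, hs⟩ := exists_pinned x₁ y₁ x₂ y₂ (κ' / c) hx₁ hy₁ hx₂ hy₂ hκ
      refine (ihp (κ' / c) hκ hidκ s hs).trans ?_
      refine hunif x₁ y₁ x₂ y₂ x₃ y₃ x₄ y₄ n₁ n₂ n₃ n₄ n₅ n₆ n₇ n₈ c (κ' / c) hx₁ hy₁ hx₂ hy₂ hx₃ hy₃ hx₄ hy₄
        hFU hc hid hκ s s' hs (isPinned_congr_weight ?_ hs')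
      field_simp

/-- **The skeleton theorem** (concludes the crux BY NAME; sorries enter only through the five named stubs):
`BetaProductSector` from HODGE TYPE, LIN CONSTANT, GENERATION, UNIFORM STEP (stubs), VALUE (landed) and the LINEAR STEP
(landed modulo crux 3). [cite: KontsevichZagier2001, §1.2 Conjecture 1] -/
theorem BetaProductSector_of : BetaProductSector :=
  betaProductSector_of_stubs stub_hodgeType stub_linConstant stub_combGeneration stub_uniformStep
    Summit.KontsevichZagierPeriods.FermatIsogeny.BetaProductSectorStubs.stub_productValue
    (Summit.KontsevichZagierPeriods.FermatIsogeny.BetaProductSectorStubs.stub_linearFactor_of_betaLinearSector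
      stub_betaLinearSector)

end Summit.KontsevichZagierPeriods.KontsevichZagierPeriods.Cruxes.BetaProductSector.Registered

end
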